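import Summits.Ventures.YMGap.RobustBall.CentreProjection
import Summits.Ventures.YMGap.RobustBall.ZNFluxPeeling
import Literature.MathematicalPhysics.QuantumFieldTheory.QuasiLocalGaugePerturbationKernels
import HarnessLib

/-!
# RobustBall/CentreProjectionFlux — centre projection for FLUX-LOCAL perturbations: the `SU(N)` Wilson loop of
# `⟨·⟩_{β,W,L}` is dominated by the Wilson loop of an induced `ℤ_N` gauge theory with NON-WILSON plaquette-flux
# weights (Wilson part + the twist defect of `W`), uniformly in the background — the centre-TUBE bound

HONEST FRAMING: venture file of the cell `pub-ymgap` (QuantumFields programme), track Y2 ROBUST-BALL, seat ds-4 g8.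
WHAT THIS IS: an INEQUALITY BETWEEN LATTICE EXPECTATIONS on a finite torus («centre dominance is stable»): for
every `N ≥ 1`, `d`, torus `L`, tree coupling `β` and every perturbation `W` of the Wilson action whose TWIST DEFECT is
plaquette-flux-local — `W(ζ_k U) = c(U) + ∑_q g_q((curl k)_q, U)` for all twists `k : links → ℤ/N` (`IsFluxLocal a W`
when `|g| ≤ a`; `a = 0` contains every twist-blind / linkwise centre-blind `W`, and `W_b + ∑_q f_q(U_q)` for ANY
plaquette densities `f_q` of ANY `N`-ality is flux-local with `a = ½ max osc f_q`, `CentreTubeMembers`) —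
`|⟨(1/N) Re tr U_{∂R×T}⟩_{β,W,L}| ≤ sup_U ‖⟨ψ(∮_{∂R×T} k)⟩_{G_U}‖`, the right side being the Wilson loop of the
`ℤ_N` lattice gauge theory with the INHOMOGENEOUS NON-WILSON flux weights `G_U(p, s) = β Re(ψ(s) tr U_p) − g_p(s, U)`
(`znLoopFlux`); with `ZNFluxPeeling` (`|G_U| ≤ |β|N + a`, `c = 2(d−1)(|β|N + a) ≤ 1`):
`|⟨W_{R×T}⟩_{β,W,L}| ≤ (4 c^T)^R` (`abs_wilsonLoop_le_of_isFluxLocal`).  No smallness, range or window is asked of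
the twist-INVARIANT part `c(U)` of `W`.  Nothing about the continuum limit or a Clay-sense mass gap; no confinement
claim for `SU(N)` beyond the inequality + the `ℤ_N`-layer bound.

Mechanism (as printed for the blind case: J. Fröhlich, Phys. Lett. B 83 (1979) 195; G. Mack, V. B. Petkova, Ann.
Phys. 123 (1979) 442, §2; the flux-local extension is this file's): product Haar is invariant under `U ↦ ζ_k·U`;
averaging numerator and normaliser of `⟨W_C⟩_{β,W}` over all twists and using
`S(ζ_k U) = N·#plaquettes − ∑_p Re(ψ((curl k)_p) tr U_p)`, `W(ζ_k U) = c(U) + ∑_p g_p((curl k)_p, U)` and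
`tr(ζ_k U)_C = ψ(∮_C k) tr U_C` turns both into integrals of the SAME positive density
`G(U) ∝ e^{−c(U)} Z^{ℤ_N}_{G_U}` against `loopTrace · znLoopFlux` resp. `1`.
-/

noncomputable section

open MeasureTheory Finset
open Literature.MathematicalPhysics.QuantumLattice (fundamentalRep fundamentalRep_apply continuous_fundamentalRep)
open Literature.MathematicalPhysics.QuantumFieldTheory

namespace Summit.Ventures.YMGap.RobustBall

variable {d L N : ℕ} [NeZero L] [NeZero N]

/-! ### Flux-local perturbations -/

/-- **`IsFluxLocal a W`** — the TWIST DEFECT of `W` is plaquette-flux-local with amplitude `a`: there are a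
twist-invariant part `c(U)` (arbitrary: no smallness, range or window) and plaquette defects `g_q(s, U)` with
`|g_q(s, U)| ≤ a` such that for every linkwise twist `k : links → ℤ/N`,
`W.total (ζ_k · U) = c(U) + ∑_q g_q((curl k)_q, U)`.  The bound `|g_q(s, U)| ≤ a` is asked for EVERY flux value
`s : ℤ/N` INCLUDING `s = 0` and every background `U` (the pair `(c, g)` is not normalised; re-centring `g_q(·, U)` by
a `U`-dependent constant moves it into `c`).  `a = 0` is EXACTLY the twist-blind class (`isFluxLocal_zero_iff_isTwistBlind`;
= linkwise centre-blind `IsCentreBlind` by `CentreSchur`); `W_b + ∑_q f_q(U_q)` (`W_b` twist-blind of any size; `f_q` the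
densities of an inhomogeneous plaquette action in the carrier — measurable bounded CLASS functions — of any `N`-ality)
is flux-local with `a = ½ max_q osc f_q`, e.g. the bond-disordered Wilson couplings `−δ_q Re tr U_q`, `|δ_q| ≤ δ`,
have `a = N·δ` in tree units (`CentreTubeMembers`).  NOT flux-local: the screening loop terms of `not_areaLawOnBallC`
(defect = `ψ` of the flux through a large loop) and, more generally, multi-plaquette terms of nonzero `N`-ality (a
`1×2` rectangle's defect reads two fluxes) — the tube is open only in the single-plaquette flux directions. [folklore] -/
def IsFluxLocal (a : ℝ) (W : Perturbation d L N) : Prop :=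
  ∃ (c : GaugeConfig d L (SUN N) → ℝ) (g : Plaquette d L → ZMod N → GaugeConfig d L (SUN N) → ℝ),
    (∀ q s U, |g q s U| ≤ a) ∧ ∀ (k : Edge d L → ZMod N) (U : GaugeConfig d L (SUN N)),
      W.total (twistOf k * U) = c U + ∑ q : Plaquette d L, g q (plaqSum k q.1 q.2.1.1 q.2.1.2) U

/-- Monotonicity of the amplitude. [folklore] -/
theorem IsFluxLocal.mono {a a' : ℝ} (h : a ≤ a') {W : Perturbation d L N} (hW : IsFluxLocal a W) :
    IsFluxLocal a' W := by
  obtain ⟨c, g, hg, hW⟩ := hW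
  exact ⟨c, g, fun q s U => (hg q s U).trans h, hW⟩

/-- **Twist-blind perturbations are flux-local with amplitude `0`** (`c = W.total`, `g = 0`). [folklore] -/
theorem IsTwistBlind.isFluxLocal {W : Perturbation d L N} (hW : IsTwistBlind W) : IsFluxLocal 0 W :=
  ⟨W.total, fun _ _ _ => 0, fun _ _ _ => by simp, fun k U => by simp [hW k U]⟩

/-- **Linkwise centre-blind perturbations are flux-local with amplitude `0`.** [folklore] -/
theorem IsCentreBlind.isFluxLocal {W : Perturbation d L N} (hW : IsCentreBlind W) : IsFluxLocal 0 W :=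
  hW.isTwistBlind.isFluxLocal

omit [NeZero L] in
/-- The trivial twist `k = 0` is the identity configuration. [folklore] -/
theorem twistOf_zero : twistOf (0 : Edge d L → ZMod N) = 1 := by
  funext e; simp [twistOf]

/-- **Amplitude `0` is exactly twist-blindness**: a flux-local perturbation with `a = 0` has `g = 0`, so
`W(ζ_k U) = c(U) = W(ζ_0 U) = W(U)`. [folklore] -/
theorem IsFluxLocal.isTwistBlind {W : Perturbation d L N} (hW : IsFluxLocal 0 W) : IsTwistBlind W := by
  obtain ⟨c, g, hg, hW⟩ := hW
  have hg0 : ∀ q s U, g q s U = 0 := fun q s U => abs_nonpos_iff.1 (hg q s U)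
  have hc : ∀ k U, W.total (twistOf k * U) = c U := fun k U => by
    rw [hW k U, Finset.sum_eq_zero fun q _ => hg0 q _ U, add_zero]
  intro k U
  rw [hc k U, ← hc 0 U, twistOf_zero, one_mul]

/-- **`IsFluxLocal 0 W ↔ IsTwistBlind W`** (rb-theory T-P1; `↔ IsCentreBlind W` by `isCentreBlind_iff_isTwistBlind`,
`CentreSchur`): the tube of radius `0` is the centre-blind subspace. [folklore] -/
theorem isFluxLocal_zero_iff_isTwistBlind (W : Perturbation d L N) : IsFluxLocal 0 W ↔ IsTwistBlind W :=
  ⟨IsFluxLocal.isTwistBlind, IsTwistBlind.isFluxLocal⟩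

/-- Flux-local perturbations are stable under sums (amplitudes add). [folklore] -/
theorem IsFluxLocal.add {a a' : ℝ} {W W' : Perturbation d L N} (hW : IsFluxLocal a W) (hW' : IsFluxLocal a' W') :
    IsFluxLocal (a + a') (W + W') := by
  obtain ⟨c, g, hg, hW⟩ := hW
  obtain ⟨c', g', hg', hW'⟩ := hW'
  refine ⟨fun U => c U + c' U, fun q s U => g q s U + g' q s U, fun q s U => ?_, fun k U => ?_⟩
  · exact (abs_add_le _ _).trans (add_le_add (hg q s U) (hg' q s U))
  · rw [QuasiLocalGaugePerturbation.total_add, Pi.add_apply, hW k U, hW' k U, Finset.sum_add_distrib]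
    ring

/-- **A twist-blind part costs nothing**: `W_b + W` is flux-local with the amplitude of `W`. [folklore] -/
theorem IsFluxLocal.twistBlind_add {a : ℝ} {Wb W : Perturbation d L N} (hb : IsTwistBlind Wb)
    (hW : IsFluxLocal a W) : IsFluxLocal a (Wb + W) := by
  simpa using hb.isFluxLocal.add hW

/-! ### The induced `ℤ_N` gauge theory with non-Wilson flux weights -/

/-- The flux weights of the background `U` with defect `g`: `G_U(p, s) = β Re(ψ(s) tr U_p) − g_p(s, U)`. [folklore] -/
def fluxWeights (β : ℝ) (g : Plaquette d L → ZMod N → GaugeConfig d L (SUN N) → ℝ)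
    (U : GaugeConfig d L (SUN N)) : Plaquette d L → ZMod N → ℝ :=
  fun p s => β * (ψ N s * ((plaquetteHolonomy U p.1 p.2.1.1 p.2.1.2 : SUN N) : Matrix (Fin N) (Fin N) ℂ).trace).re
    - g p s U

/-- **The `ℤ_N` Wilson loop of the induced theory with flux weights `G_U`.** [folklore] -/
def znLoopFlux (β : ℝ) (g : Plaquette d L → ZMod N → GaugeConfig d L (SUN N) → ℝ) (U : GaugeConfig d L (SUN N))
    (x : Site d L) (i j : Fin d) (R T : ℕ) : ℂ :=
  FiniteGibbs.cavg (ZNFlux.znWG (fluxWeights β g U)) fun k => ψ N (loopSum k x i j R T)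

omit [NeZero L] in
/-- `|G_U(p, s)| ≤ |β| N + a` when `|g| ≤ a`. [folklore] -/
theorem abs_fluxWeights_le (β : ℝ) {g : Plaquette d L → ZMod N → GaugeConfig d L (SUN N) → ℝ} {a : ℝ}
    (hg : ∀ q s U, |g q s U| ≤ a) (U : GaugeConfig d L (SUN N)) (p : Plaquette d L) (s : ZMod N) :
    |fluxWeights β g U p s| ≤ |β| * N + a := by
  unfold fluxWeights
  refine (abs_sub _ _).trans (add_le_add ?_ (hg p s U))
  rw [abs_mul]
  refine mul_le_mul_of_nonneg_left ((Complex.abs_re_le_norm _).trans ?_) (abs_nonneg β)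
  rw [norm_mul, norm_ψ, one_mul]
  exact norm_trace_le _

/-- `‖znLoopFlux‖ ≤ 1` always. [folklore] -/
theorem norm_znLoopFlux_le_one (β : ℝ) (g : Plaquette d L → ZMod N → GaugeConfig d L (SUN N) → ℝ)
    (U : GaugeConfig d L (SUN N)) (x : Site d L) (i j : Fin d) (R T : ℕ) : ‖znLoopFlux β g U x i j R T‖ ≤ 1 :=
  FiniteGibbs.norm_cavg_le (fun k => (ZNFlux.znWG_pos _ k).le) (FiniteGibbs.mass_pos_of_pos (ZNFlux.znWG_pos _))
    fun _ => (norm_ψ _).le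

/-- **The induced non-Wilson `ℤ_N` Wilson loop obeys the uniform area-law bound** `‖znLoopFlux‖ ≤ (4 c^T)^R`,
`c = 2(d−1)(|β|N + a) ≤ 1`, `N ≥ 2`, `i ≠ j`, `2R, 2T ≤ L` (`ZNFlux.norm_cavg_ψ_loopSum_le`). [folklore] -/
theorem norm_znLoopFlux_le (hN : 2 ≤ N) (β : ℝ) {g : Plaquette d L → ZMod N → GaugeConfig d L (SUN N) → ℝ} {a : ℝ}
    (ha : 0 ≤ a) (hg : ∀ q s U, |g q s U| ≤ a) {c : ℝ} (hc : 2 * ((d - 1 : ℕ) : ℝ) * (|β| * N + a) ≤ c)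
    (hc1 : c ≤ 1) (U : GaugeConfig d L (SUN N)) (x : Site d L) {i j : Fin d} (hij : i ≠ j) {R T : ℕ}
    (hR : 2 * R ≤ L) (hT : 2 * T ≤ L) : ‖znLoopFlux β g U x i j R T‖ ≤ (4 * c ^ T) ^ R :=
  ZNFlux.norm_cavg_ψ_loopSum_le hN hij (by positivity) (abs_fluxWeights_le β hg U) hc hc1 x hR hT

/-! ### The centre-projection bound for flux-local perturbations -/

/-- **THE CENTRE-PROJECTION BOUND, FLUX-LOCAL FORM.**  For EVERY perturbation `W` of the `SU(N)` Wilson action with a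
plaquette-flux-local twist defect `W(ζ_k U) = c(U) + ∑_q g_q((curl k)_q, U)` (no smallness, range or window asked of
the twist-invariant part `c`) and every uniform bound `M` on the Wilson loop of the induced `ℤ_N` gauge theory with the
non-Wilson flux weights `G_U = β Re(ψ tr U_p) − g_p(·, U)` over all backgrounds `U`,
`|⟨(1/N) Re tr U_{∂R×T}⟩_{β,W,L}| ≤ M`.  HONEST LABEL: an inequality between lattice expectations; the `ℤ_N` input
`M` is supplied by name (`norm_znLoopFlux_le`). [cite: Frohlich1979ZN, Eq. (7)–(9)] -/
theorem abs_expectation_wilsonLoop_le_of_fluxLocal (W : Perturbation d L N) {c : GaugeConfig d L (SUN N) → ℝ}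
    {g : Plaquette d L → ZMod N → GaugeConfig d L (SUN N) → ℝ}
    (hW : ∀ (k : Edge d L → ZMod N) (U : GaugeConfig d L (SUN N)),
      W.total (twistOf k * U) = c U + ∑ q : Plaquette d L, g q (plaqSum k q.1 q.2.1.1 q.2.1.2) U)
    (β : ℝ) (x : Site d L) (i j : Fin d) (R T : ℕ) {M : ℝ}
    (hM : ∀ U : GaugeConfig d L (SUN N), ‖znLoopFlux β g U x i j R T‖ ≤ M) :
    |W.expectation (fundamentalRep (Fin N)) β (wilsonLoop (fundamentalRep (Fin N)) x i j R T)| ≤ M := by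
  set ρ := fundamentalRep (Fin N) with hρdef
  have hρ : Continuous ρ := continuous_fundamentalRep (Fin N)
  set π : Measure (GaugeConfig d L (SUN N)) := Measure.pi fun _ : Edge d L => haarProbability (SUN N) with hπ
  haveI : IsProbabilityMeasure π := by rw [hπ]; infer_instance
  set E : GaugeConfig d L (SUN N) → ℝ := fun U => -β * wilsonAction ρ U - W.total U with hE
  -- measurability / boundedness of the energy
  have hEm : Measurable E := QuasiLocalGaugePerturbation.measurable_action ρ hρ β W
  obtain ⟨CE, hCE⟩ := QuasiLocalGaugePerturbation.exists_abs_action_le ρ hρ β W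
  have hexp_m : Measurable fun U => Real.exp (E U) := Real.measurable_exp.comp hEm
  have hexp_bd : ∀ U, ‖Real.exp (E U)‖ ≤ Real.exp CE := fun U => by
    rw [Real.norm_eq_abs, abs_of_pos (Real.exp_pos _)]; exact Real.exp_le_exp.2 (le_of_abs_le (hCE U))
  have hexp_int : Integrable (fun U => Real.exp (E U)) π :=
    Integrable.of_bound hexp_m.aestronglyMeasurable (Real.exp CE) (Filter.Eventually.of_forall hexp_bd)
  have hZpos : 0 < ∫ U, Real.exp (E U) ∂π := integral_exp_pos hexp_int
  -- the complex integrand `g₁ = e^{E} · loopTrace`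
  set lt := loopTrace (N := N) x i j R T with hlt
  have hlt_m : Measurable lt := (continuous_loopTrace x i j R T).measurable
  set g₁ : GaugeConfig d L (SUN N) → ℂ := fun U => (Real.exp (E U) : ℂ) * lt U with hg₁
  -- Step 1: the expectation as a tilted integral
  have hexp_eq : W.expectation ρ β (wilsonLoop ρ x i j R T) =
      (∫ U, Real.exp (E U) * wilsonLoop ρ x i j R T U ∂π) / ∫ U, Real.exp (E U) ∂π := by
    rw [QuasiLocalGaugePerturbation.expectation, QuasiLocalGaugePerturbation.perturbedMeasure_eq_tilted ρ hρ β W,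
      ← hπ, integral_tilted]
    simp only [smul_eq_mul]
    rw [← integral_div]
    exact integral_congr_ae (Filter.Eventually.of_forall fun U => by ring)
  -- Step 2: real part of the complex integral
  have hg₁_int : Integrable g₁ π := by
    refine Integrable.of_bound ((Complex.measurable_ofReal.comp hexp_m).mul hlt_m).aestronglyMeasurable
      (Real.exp CE) (Filter.Eventually.of_forall fun U => ?_)
    rw [hg₁]; dsimp only
    rw [norm_mul, Complex.norm_real]
    calc ‖Real.exp (E U)‖ * ‖lt U‖ ≤ Real.exp CE * 1 :=
          mul_le_mul (hexp_bd U) (norm_loopTrace_le_one x i j R T U) (norm_nonneg _) (Real.exp_pos _).le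
      _ = Real.exp CE := mul_one _
  have hre : ∫ U, Real.exp (E U) * wilsonLoop ρ x i j R T U ∂π = (∫ U, g₁ U ∂π).re := by
    have h := integral_re hg₁_int
    simp only [RCLike.re_to_complex] at h
    rw [← h]
    refine integral_congr_ae (Filter.Eventually.of_forall fun U => ?_)
    show Real.exp (E U) * wilsonLoop ρ x i j R T U = ((Real.exp (E U) : ℂ) * lt U).re
    rw [Complex.re_ofReal_mul, hlt, wilsonLoop_eq_re_loopTrace]
  -- Step 3: twisted integrands — the energy of a twisted configuration in flux form
  set P := Fintype.card (Plaquette d L) with hP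
  set K := Fintype.card (Edge d L → ZMod N) with hK
  have hK0 : (0 : ℝ) < K := by rw [hK]; exact_mod_cast Fintype.card_pos
  have hEtwist : ∀ (k : Edge d L → ZMod N) (U : GaugeConfig d L (SUN N)),
      E (twistOf k * U) = (-β * ((N : ℝ) * P) - c U) +
        ∑ p : Plaquette d L, fluxWeights β g U p (plaqSum k p.1 p.2.1.1 p.2.1.2) := by
    intro k U
    simp only [hE]
    rw [wilsonAction_twist_eq, hW k U]
    unfold twistEnergy fluxWeights
    rw [Finset.sum_sub_distrib, ← Finset.mul_sum]
    ring
  -- the common positive density `G`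
  set G : GaugeConfig d L (SUN N) → ℝ := fun U =>
    (K : ℝ)⁻¹ * (Real.exp (-β * ((N : ℝ) * P) - c U) * FiniteGibbs.mass (ZNFlux.znWG (fluxWeights β g U))) with hG
  have hmassU : ∀ U, 0 < FiniteGibbs.mass (ZNFlux.znWG (N := N) (L := L) (fluxWeights β g U)) := fun U =>
    FiniteGibbs.mass_pos_of_pos (ZNFlux.znWG_pos _)
  have hG0 : ∀ U, 0 ≤ G U := fun U =>
    mul_nonneg (inv_nonneg.2 hK0.le) (mul_nonneg (Real.exp_pos _).le (hmassU U).le)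
  have hsum₀ : ∀ U, (K : ℝ)⁻¹ • ∑ k : Edge d L → ZMod N, Real.exp (E (twistOf k * U)) = G U := by
    intro U
    simp only [hEtwist, Real.exp_add, ← Finset.mul_sum, smul_eq_mul, hG, FiniteGibbs.mass, ZNFlux.znWG]
  have hsum₁ : ∀ U, (K : ℝ)⁻¹ • ∑ k : Edge d L → ZMod N, g₁ (twistOf k * U) =
      (G U : ℂ) * (lt U * znLoopFlux β g U x i j R T) := by
    intro U
    have hm : (FiniteGibbs.mass (ZNFlux.znWG (fluxWeights β g U)) : ℂ) ≠ 0 := by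
      rw [Ne, Complex.ofReal_eq_zero]; exact (hmassU U).ne'
    simp only [hg₁, hlt, loopTrace_twist, hEtwist, Real.exp_add, Complex.ofReal_mul]
    have hfac : ∑ k : Edge d L → ZMod N, (Real.exp (-β * ((N : ℝ) * P) - c U) : ℂ) *
        (Real.exp (∑ p : Plaquette d L, fluxWeights β g U p (plaqSum k p.1 p.2.1.1 p.2.1.2)) : ℂ) *
          (ψ N (loopSum k x i j R T) * loopTrace x i j R T U) =
        (Real.exp (-β * ((N : ℝ) * P) - c U) : ℂ) * loopTrace x i j R T U *
          ∑ k : Edge d L → ZMod N, (ZNFlux.znWG (fluxWeights β g U) k : ℂ) * ψ N (loopSum k x i j R T) := by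
      rw [Finset.mul_sum]
      refine Finset.sum_congr rfl fun k _ => ?_
      rw [ZNFlux.znWG]; ring
    rw [hfac, znLoopFlux, FiniteGibbs.cavg, hG, Complex.real_smul]
    push_cast
    field_simp
  -- Step 4: the two averaged integrals
  have hZ : ∫ U, Real.exp (E U) ∂π = ∫ U, G U ∂π := by
    rw [integral_eq_avg_twist (fun U => Real.exp (E U)) fun k => ?_]
    · exact integral_congr_ae (Filter.Eventually.of_forall hsum₀)
    · exact (measurePreserving_twistEquiv k).integrable_comp_emb (twistEquiv k).measurableEmbedding |>.2 hexp_int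
  have hN₁ : ∫ U, g₁ U ∂π = ∫ U, (G U : ℂ) * (lt U * znLoopFlux β g U x i j R T) ∂π := by
    rw [integral_eq_avg_twist g₁ fun k => ?_]
    · exact integral_congr_ae (Filter.Eventually.of_forall hsum₁)
    · exact (measurePreserving_twistEquiv k).integrable_comp_emb (twistEquiv k).measurableEmbedding |>.2 hg₁_int
  -- Step 5: the norm bound
  have hGint : Integrable G π := by
    have h1 : Integrable (fun U => ∑ k : Edge d L → ZMod N, Real.exp (E (twistOf k * U))) π :=
      integrable_finsetSum Finset.univ fun k _ =>
        (measurePreserving_twistEquiv k).integrable_comp_emb (twistEquiv k).measurableEmbedding |>.2 hexp_int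
    refine (integrable_congr (Filter.Eventually.of_forall fun U => ?_)).1 (h1.smul ((K : ℝ)⁻¹))
    show (K : ℝ)⁻¹ • ∑ k : Edge d L → ZMod N, Real.exp (E (twistOf k * U)) = G U
    exact hsum₀ U
  have hbound : ‖∫ U, g₁ U ∂π‖ ≤ M * ∫ U, Real.exp (E U) ∂π := by
    rw [hN₁, hZ, ← integral_const_mul]
    refine (norm_integral_le_integral_norm _).trans (integral_mono_of_nonneg
      (Filter.Eventually.of_forall fun U => norm_nonneg _) (hGint.const_mul M)
      (Filter.Eventually.of_forall fun U => ?_))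
    show ‖(G U : ℂ) * (lt U * znLoopFlux β g U x i j R T)‖ ≤ M * G U
    rw [norm_mul, Complex.norm_real, Real.norm_eq_abs, abs_of_nonneg (hG0 U), norm_mul, mul_comm]
    refine mul_le_mul_of_nonneg_right ?_ (hG0 U)
    calc ‖lt U‖ * ‖znLoopFlux β g U x i j R T‖ ≤ 1 * M :=
          mul_le_mul (norm_loopTrace_le_one x i j R T U) (hM U) (norm_nonneg _) zero_le_one
      _ = M := one_mul M
  -- Step 6: conclude
  rw [hexp_eq, hre, abs_div, abs_of_pos hZpos, div_le_iff₀ hZpos]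
  exact (Complex.abs_re_le_norm _).trans hbound

/-- **THE CENTRE-TUBE BOUND**: for `N ≥ 2`, every FLUX-LOCAL perturbation `W` with amplitude `a`
(`IsFluxLocal a W`), `c = 2(d−1)(|β|N + a) ≤ 1`, `i ≠ j`, `2R, 2T ≤ L`:
`|⟨(1/N) Re tr U_{R×T}⟩_{β,W,L}| ≤ (4 c^T)^R` — uniformly in `W`, `L`, the base point and the plane.  HONEST LABEL:
strong-coupling lattice inequality (centre dominance + the `ℤ_N`-layer area law for non-Wilson flux weights);
fundamental loops; nothing continuum / spectral / Clay. [folklore] -/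
theorem abs_wilsonLoop_le_of_isFluxLocal (hN : 2 ≤ N) {β a c : ℝ} (ha : 0 ≤ a)
    (hc : 2 * ((d - 1 : ℕ) : ℝ) * (|β| * N + a) ≤ c) (hc1 : c ≤ 1) (W : Perturbation d L N) (hW : IsFluxLocal a W)
    (x : Site d L) {i j : Fin d} (hij : i ≠ j) {R T : ℕ} (hR : 2 * R ≤ L) (hT : 2 * T ≤ L) :
    |W.expectation (fundamentalRep (Fin N)) β (wilsonLoop (fundamentalRep (Fin N)) x i j R T)| ≤ (4 * c ^ T) ^ R := by
  obtain ⟨c₀, g, hg, hW⟩ := hW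
  exact abs_expectation_wilsonLoop_le_of_fluxLocal W hW β x i j R T fun U =>
    norm_znLoopFlux_le hN β ha hg hc hc1 U x hij hR hT

/-- Consistency with gen 7: the twist-blind bound `abs_wilsonLoop_le_of_isTwistBlind` is the case `a = 0`. [folklore] -/
theorem abs_wilsonLoop_le_of_isTwistBlind' (hN : 2 ≤ N) {β c : ℝ}
    (hc : 2 * ((d - 1 : ℕ) : ℝ) * |β| * N ≤ c) (hc1 : c ≤ 1) (W : Perturbation d L N) (hW : IsTwistBlind W)
    (x : Site d L) {i j : Fin d} (hij : i ≠ j) {R T : ℕ} (hR : 2 * R ≤ L) (hT : 2 * T ≤ L) :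
    |W.expectation (fundamentalRep (Fin N)) β (wilsonLoop (fundamentalRep (Fin N)) x i j R T)| ≤ (4 * c ^ T) ^ R :=
  abs_wilsonLoop_le_of_isFluxLocal hN (a := 0) le_rfl (by rw [add_zero, ← mul_assoc]; exact hc) hc1 W hW.isFluxLocal
    x hij hR hT

end Summit.Ventures.YMGap.RobustBall

end
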